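import Summits.QuantumFields.YangMills.Theorems.ColdStartUniversalityLatticeLangevinWilsonEntropyDecayMeasurable
import Summits.QuantumFields.YangMills.Theorems.ColdStartUniversalityUniformColdStartMixingFixedCutoffEntropy
import Mathlib.InformationTheory.KullbackLeibler.Basic
import HarnessLib

/-!
# Route `ColdStartUniversality` (fixed-cut-off package, entropy side): LOG-SOBOLEV ⇒ EXPONENTIAL DECAY OF THE RELATIVE ENTROPY
# `KL(law(U_t) ‖ μ_{β'})` ALONG EVERY SOLUTION of the SZZ dynamics, in Mathlib's `klDiv` currency

Helper file (seat `ym-line-csu-p1`, g21; `--supports stmt-QuantumFields-27363`), sequel of `…WilsonEntropyDecayMeasurable`.  SU(2) SZZ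
dynamics at `(L, β')`, Wilson measure `μ = μ_{β'}`:

* `klDiv_withDensity_eq_ofReal` — for a probability density `0 ≤ g ≤ M` (`∫ g dμ = 1`): `klDiv (g·μ) μ = ofReal(∫ g log g dμ)`;
* `exists_bounded_density_of_le_smul` — `ν ≤ D·μ` ⇒ `ν = g·μ` with a measurable `0 ≤ g ≤ D`;
* ★ `withDensity_bind_transition_eq` — REVERSIBILITY ON MEASURES: `(g·μ) κ_u = (κ_u g)·μ` — the law at time `u` of the dynamics
  started from `g·μ` has density `κ_u g = P_u g` (detailed balance `integral_mul_transition_symm_su2_of_measurable`);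
* ★★ `klDiv_map_le_exp_of_generatorLogSobolev` — under the generator-form log-Sobolev inequality with constant `ρ > 0` on `C³`
  cylinders: for EVERY solution `U` from a deterministic start on ANY probability space, every lattice time `τ₀ > 0` and `u ≥ 0`,
  `KL(law(U_{τ₀+u}) ‖ μ_{β'}) ≤ e^{−4ρu} · KL(law(U_{τ₀}) ‖ μ_{β'})`
  (Markov property through THE transition kernels + Chapman–Kolmogorov, the density bound after a positive time
  `map_le_smul_wilsonMeasure_of_le`, reversibility on measures, and `entropy_transition_le_exp_of_generatorLogSobolev_of_measurable`).

THEOREMS ONLY, no definition, no sorry.  HONEST FRAMING: RECORD-rung R3 plumbing at FIXED cut-off; the log-Sobolev inequality is the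
HYPOTHESIS; nothing K-uniform is proved; no crux, rung or summit statement is proved; the Yang–Mills mass gap is NOT proved.
-/

set_option autoImplicit false

noncomputable section

namespace Summit.QuantumFields.YangMills.Theorems.ColdStartUniversality

open MeasureTheory ProbabilityTheory InformationTheory Filter Set Topology
open scoped BigOperators NNReal ENNReal
open Literature.Probability.Process Literature.MathematicalPhysics.QuantumFieldTheory
open Literature.MathematicalPhysics.QuantumLattice (fundamentalRep fundamentalLatticeRep continuous_fundamentalRep)

variable {L : ℕ} [NeZero L]

/-! ## §1. `klDiv` of a measure with a bounded density -/

/-- **`KL(g·μ ‖ μ) = ∫ g log g dμ`** for a probability measure `μ` and a bounded measurable probability density `g ≥ 0`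
(`klDiv = ∫⁻ klFun(dν/dμ) dμ`, `klFun x = x log x + 1 − x`, `dν/dμ = g` a.e., `∫ g = 1`). [folklore] -/
theorem klDiv_withDensity_eq_ofReal {X : Type*} [MeasurableSpace X] (μ : Measure X) [IsProbabilityMeasure μ] {g : X → ℝ}
    (hgm : Measurable g) (hg0 : ∀ x, 0 ≤ g x) {M : ℝ} (hgM : ∀ x, g x ≤ M) (hmass : ∫ x, g x ∂μ = 1) :
    klDiv (μ.withDensity fun x => ENNReal.ofReal (g x)) μ = ENNReal.ofReal (∫ x, g x * Real.log (g x) ∂μ) := by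
  have hgi : Integrable g μ := Integrable.of_bound hgm.aestronglyMeasurable M
    (ae_of_all _ fun x => by rw [Real.norm_eq_abs, abs_of_nonneg (hg0 x)]; exact hgM x)
  set ν : Measure X := μ.withDensity fun x => ENNReal.ofReal (g x) with hν
  haveI : IsFiniteMeasure ν := isFiniteMeasure_withDensity_ofReal hgi.hasFiniteIntegral
  have hac : ν ≪ μ := withDensity_absolutelyContinuous _ _
  have hrn : ν.rnDeriv μ =ᵐ[μ] fun x => ENNReal.ofReal (g x) :=
    Measure.rnDeriv_withDensity μ hgm.ennreal_ofReal
  rw [klDiv_eq_lintegral_klFun_of_ac hac]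
  have e1 : ∫⁻ x, ENNReal.ofReal (klFun (ν.rnDeriv μ x).toReal) ∂μ = ∫⁻ x, ENNReal.ofReal (klFun (g x)) ∂μ := by
    refine lintegral_congr_ae ?_
    filter_upwards [hrn] with x hx
    rw [hx, ENNReal.toReal_ofReal (hg0 x)]
  rw [e1]
  -- `klFun ∘ g` is bounded, non-negative, integrable
  have hglog_m : Measurable fun x => g x * Real.log (g x) := hgm.mul (Real.measurable_log.comp hgm)
  obtain ⟨C, hC⟩ := (isCompact_Icc (a := (0 : ℝ)) (b := M)).exists_bound_of_continuousOn Real.continuous_mul_log.continuousOn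
  have hglog_i : Integrable (fun x => g x * Real.log (g x)) μ :=
    Integrable.of_bound hglog_m.aestronglyMeasurable C (ae_of_all _ fun x => hC (g x) ⟨hg0 x, hgM x⟩)
  have hkl : ∀ x, klFun (g x) = g x * Real.log (g x) + 1 - g x := fun x => klFun_apply _
  have hkli : Integrable (fun x => klFun (g x)) μ := by
    have : Integrable (fun x => g x * Real.log (g x) + 1 - g x) μ := (hglog_i.add (integrable_const 1)).sub hgi
    exact this.congr (ae_of_all _ fun x => (hkl x).symm)
  rw [← ofReal_integral_eq_lintegral_ofReal hkli (ae_of_all _ fun x => klFun_nonneg (hg0 x))]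
  congr 1
  simp_rw [hkl]
  have iA : Integrable (fun x => g x * Real.log (g x) + 1) μ := hglog_i.add (integrable_const 1)
  rw [integral_sub iA hgi, integral_add hglog_i (integrable_const 1), integral_const, probReal_univ, one_smul, hmass]
  ring

/-- **A dominated measure has a bounded measurable density**: `ν ≤ D·μ` (`D ≥ 0`, σ-finite) ⇒ `ν = g·μ` for a measurable
`0 ≤ g ≤ D` (`g = min(D, dν/dμ)`). [folklore] -/
theorem exists_bounded_density_of_le_smul {X : Type*} [MeasurableSpace X] {ν μ : Measure X} [SigmaFinite ν] [SigmaFinite μ]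
    {D : ℝ} (hD : 0 ≤ D) (h : ν ≤ (ENNReal.ofReal D) • μ) :
    ∃ g : X → ℝ, Measurable g ∧ (∀ x, 0 ≤ g x) ∧ (∀ x, g x ≤ D) ∧ ν = μ.withDensity fun x => ENNReal.ofReal (g x) := by
  have hac : ν ≪ μ := Measure.absolutelyContinuous_of_le_smul h
  have hbd := KLDensity.rnDeriv_le_const_of_le_smul h
  refine ⟨fun x => min D (ν.rnDeriv μ x).toReal, measurable_const.min (ν.measurable_rnDeriv μ).ennreal_toReal,
    fun x => le_min hD ENNReal.toReal_nonneg, fun x => min_le_left _ _, ?_⟩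
  calc ν = μ.withDensity (ν.rnDeriv μ) := (Measure.withDensity_rnDeriv_eq ν μ hac).symm
    _ = μ.withDensity fun x => ENNReal.ofReal (min D (ν.rnDeriv μ x).toReal) := by
        refine withDensity_congr_ae ?_
        filter_upwards [hbd] with x hx
        have hne : ν.rnDeriv μ x ≠ ∞ := ne_top_of_le_ne_top ENNReal.ofReal_ne_top hx
        have hle : (ν.rnDeriv μ x).toReal ≤ D := ENNReal.toReal_le_of_le_ofReal hD hx
        rw [min_eq_right hle, ENNReal.ofReal_toReal hne]

/-! ## §2. Reversibility on measures: `(g·μ) κ_u = (κ_u g)·μ` -/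

/-- ★ **The law at time `u` from the initial law `g·μ_{β'}` has density `κ_u g`**: `(g·μ_{β'}).bind κ_u = (κ_u g)·μ_{β'}` for every
bounded measurable `g ≥ 0` and every realising kernel family — detailed balance tested on `g` and indicators.
[cite: ShenZhuZhu2022, §3 (p. 13)] -/
theorem withDensity_bind_transition_eq (L : ℕ) [NeZero L] (β' : ℝ)
    (κ : ℝ≥0 → Kernel (GaugeConfig 3 L (Matrix.specialUnitaryGroup (Fin 2) ℂ))
      (GaugeConfig 3 L (Matrix.specialUnitaryGroup (Fin 2) ℂ))) [∀ t, IsMarkovKernel (κ t)]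
    (hreal : ∀ (t : ℝ≥0) (x : GaugeConfig 3 L (Matrix.specialUnitaryGroup (Fin 2) ℂ))
        (Ω : Type) [MeasurableSpace Ω] (P : Measure Ω) [IsProbabilityMeasure P]
        (W : ℝ≥0 → Ω → (Edge 3 L × NoiseIdx 2 → ℝ)) (hW : IsFlatBrownian W P)
        (U : ℝ≥0 → Ω → GaugeConfig 3 L (Matrix.specialUnitaryGroup (Fin 2) ℂ)),
        (∀ ω, U 0 ω = x) →
        (latticeLangevinDynamics (fundamentalLatticeRep 2) β').IsSolution (fundamentalRep (Fin 2))
          hW.natFiltration P W U →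
        κ t x = P.map (U t))
    (u : ℝ≥0) {g : GaugeConfig 3 L (Matrix.specialUnitaryGroup (Fin 2) ℂ) → ℝ} (hgm : Measurable g) (hg0 : ∀ x, 0 ≤ g x)
    {M : ℝ} (hgM : ∀ x, g x ≤ M) :
    ((wilsonMeasure (d := 3) (L := L) (fundamentalRep (Fin 2)) β').withDensity fun x => ENNReal.ofReal (g x)).bind (κ u) =
      (wilsonMeasure (d := 3) (L := L) (fundamentalRep (Fin 2)) β').withDensity
        fun x => ENNReal.ofReal (∫ y, g y ∂(κ u x)) := by
  classical
  haveI := secondCountableTopology_su2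
  haveI := borelSpace_config L
  set μ : Measure (GaugeConfig 3 L (Matrix.specialUnitaryGroup (Fin 2) ℂ)) :=
    wilsonMeasure (d := 3) (L := L) (fundamentalRep (Fin 2)) β' with hμ
  haveI : IsProbabilityMeasure μ :=
    isProbabilityMeasure_wilsonMeasure (d := 3) (L := L) (fundamentalRep (Fin 2)) (continuous_fundamentalRep (Fin 2)) β'
  have hgb : ∀ x, |g x| ≤ M := fun x => by rw [abs_of_nonneg (hg0 x)]; exact hgM x
  have hKg_m : Measurable fun x => ∫ y, g y ∂(κ u x) := (hgm.stronglyMeasurable.integral_kernel (κ := κ u)).measurable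
  have hKg0 : ∀ x, 0 ≤ ∫ y, g y ∂(κ u x) := fun x => integral_nonneg fun y => hg0 y
  refine Measure.ext fun A hA => ?_
  rw [Measure.bind_apply hA (κ u).measurable.aemeasurable,
    lintegral_withDensity_eq_lintegral_mul _ hgm.ennreal_ofReal ((κ u).measurable_coe hA), withDensity_apply _ hA,
    ← lintegral_indicator hA]
  simp only [Pi.mul_apply]
  -- both sides as real integrals
  have e1 : ∀ x, ENNReal.ofReal (g x) * (κ u x) A = ENNReal.ofReal (g x * ∫ y, A.indicator (fun _ => (1 : ℝ)) y ∂(κ u x)) := by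
    intro x
    rw [integral_indicator_const _ hA, smul_eq_mul, mul_one, ← ofReal_measureReal, ENNReal.ofReal_mul (hg0 x)]
  have e2 : ∀ x, A.indicator (fun x => ENNReal.ofReal (∫ y, g y ∂(κ u x))) x =
      ENNReal.ofReal (A.indicator (fun _ => (1 : ℝ)) x * ∫ y, g y ∂(κ u x)) := by
    intro x
    by_cases hx : x ∈ A
    · rw [indicator_of_mem hx, indicator_of_mem hx, one_mul]
    · rw [indicator_of_notMem hx, indicator_of_notMem hx, zero_mul, ENNReal.ofReal_zero]
  simp_rw [e1, e2]
  have hind_m : Measurable (A.indicator fun _ => (1 : ℝ)) := measurable_const.indicator hA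
  have hind_b : ∀ x, |A.indicator (fun _ => (1 : ℝ)) x| ≤ 1 := fun x => by
    by_cases hx : x ∈ A
    · rw [indicator_of_mem hx, abs_one]
    · rw [indicator_of_notMem hx, abs_zero]; exact zero_le_one
  have hKi_m : Measurable fun x => ∫ y, A.indicator (fun _ => (1 : ℝ)) y ∂(κ u x) :=
    (hind_m.stronglyMeasurable.integral_kernel (κ := κ u)).measurable
  have i1 : Integrable (fun x => g x * ∫ y, A.indicator (fun _ => (1 : ℝ)) y ∂(κ u x)) μ :=
    Integrable.of_bound (hgm.mul hKi_m).aestronglyMeasurable (M * 1) (ae_of_all _ fun x => by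
      rw [Real.norm_eq_abs, abs_mul]
      exact mul_le_mul (hgb x) (abs_integral_le_of_abs_le_of_isProbabilityMeasure (μ := κ u x) hind_b)
        (abs_nonneg _) ((abs_nonneg _).trans (hgb x)))
  have i2 : Integrable (fun x => A.indicator (fun _ => (1 : ℝ)) x * ∫ y, g y ∂(κ u x)) μ :=
    Integrable.of_bound (hind_m.mul hKg_m).aestronglyMeasurable (1 * M) (ae_of_all _ fun x => by
      rw [Real.norm_eq_abs, abs_mul]
      exact mul_le_mul (hind_b x) (abs_integral_le_of_abs_le_of_isProbabilityMeasure (μ := κ u x) hgb)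
        (abs_nonneg _) zero_le_one)
  rw [← ofReal_integral_eq_lintegral_ofReal i1 (ae_of_all _ fun x => mul_nonneg (hg0 x)
      (integral_nonneg fun y => Set.indicator_nonneg (fun _ _ => zero_le_one) y)),
    ← ofReal_integral_eq_lintegral_ofReal i2 (ae_of_all _ fun x => mul_nonneg
      (Set.indicator_nonneg (fun _ _ => zero_le_one) x) (hKg0 x))]
  congr 1
  exact integral_mul_transition_symm_su2_of_measurable L β' κ hreal u hgm ⟨M, hgb⟩ hind_m ⟨1, hind_b⟩

/-! ## §3. The decay of `KL(law(U_t) ‖ μ_{β'})` along every solution -/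

/-- ★★ **Log-Sobolev ⇒ `KL(law(U_{τ₀+u}) ‖ μ_{β'}) ≤ e^{−4ρu} KL(law(U_{τ₀}) ‖ μ_{β'})`** for every solution `U` of the SU(2) SZZ
dynamics from a deterministic start, on ANY probability space, every lattice time `τ₀ > 0` and every `u ≥ 0`, under the
generator-form log-Sobolev inequality with constant `ρ > 0` on `C³` cylinders.  (The law at `τ₀` has a bounded density `g`
w.r.t. `μ_{β'}`; by the Markov property and reversibility the law at `τ₀ + u` is `(κ_u g)·μ_{β'}`; then
`entropy_transition_le_exp_of_generatorLogSobolev_of_measurable`.) [cite: BakryGentilLedoux2014, Thm 5.2.1] -/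
theorem klDiv_map_le_exp_of_generatorLogSobolev (L : ℕ) [NeZero L] (β' : ℝ) {ρ : ℝ} (hρ : 0 < ρ)
    (hLSgen : ∀ (f : (Edge 3 L × Fin 2 × Fin 2 × Bool → ℝ) → ℝ), ContDiff ℝ 3 f →
        let coords : GaugeConfig 3 L (Matrix.specialUnitaryGroup (Fin 2) ℂ) → (Edge 3 L × Fin 2 × Fin 2 × Bool → ℝ) :=
          fun V q => (fun z : ℂ => if q.2.2.2 then z.im else z.re)
            ((fundamentalRep (Fin 2) (V q.1) : Matrix (Fin 2) (Fin 2) ℂ) q.2.1 q.2.2.1)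
        let gen : GaugeConfig 3 L (Matrix.specialUnitaryGroup (Fin 2) ℂ) → ℝ := fun V =>
          (∑ i : Edge 3 L × Fin 2 × Fin 2 × Bool, fderiv ℝ f (coords V) (Pi.single i 1) *
              (fun z : ℂ => if i.2.2.2 then z.im else z.re)
                ((latticeLangevinDynamics (fundamentalLatticeRep 2) β').drift
                  (matrixConfig (fundamentalRep (Fin 2)) V) i.1 i.2.1 i.2.2.1) +
          1 / 2 * ∑ i : Edge 3 L × Fin 2 × Fin 2 × Bool, ∑ j : Edge 3 L × Fin 2 × Fin 2 × Bool,
            fderiv ℝ (fun z => fderiv ℝ f z (Pi.single i 1)) (coords V) (Pi.single j 1) *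
              ∑ n : Edge 3 L × NoiseIdx 2,
                (if n.1 = i.1 then (fun z : ℂ => if i.2.2.2 then z.im else z.re)
                  ((latticeLangevinDynamics (fundamentalLatticeRep 2) β').noise
                    (matrixConfig (fundamentalRep (Fin 2)) V) i.1 n.2 i.2.1 i.2.2.1) else 0) *
                (if n.1 = j.1 then (fun z : ℂ => if j.2.2.2 then z.im else z.re)
                  ((latticeLangevinDynamics (fundamentalLatticeRep 2) β').noise
                    (matrixConfig (fundamentalRep (Fin 2)) V) j.1 n.2 j.2.1 j.2.2.1) else 0))
        ρ * ((∫ V, f (coords V) ^ 2 * Real.log (f (coords V) ^ 2) ∂(wilsonMeasure (d := 3) (L := L) (fundamentalRep (Fin 2)) β')) -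
            (∫ V, f (coords V) ^ 2 ∂(wilsonMeasure (d := 3) (L := L) (fundamentalRep (Fin 2)) β')) *
              Real.log (∫ V, f (coords V) ^ 2 ∂(wilsonMeasure (d := 3) (L := L) (fundamentalRep (Fin 2)) β'))) ≤
          -∫ V, f (coords V) * gen V ∂(wilsonMeasure (d := 3) (L := L) (fundamentalRep (Fin 2)) β'))
    {Ω : Type} [MeasurableSpace Ω] {P : Measure Ω} [IsProbabilityMeasure P]
    {W : ℝ≥0 → Ω → (Edge 3 L × NoiseIdx 2 → ℝ)} (hW : IsFlatBrownian W P)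
    {U : ℝ≥0 → Ω → GaugeConfig 3 L (Matrix.specialUnitaryGroup (Fin 2) ℂ)}
    (z : GaugeConfig 3 L (Matrix.specialUnitaryGroup (Fin 2) ℂ)) (hU0 : ∀ ω, U 0 ω = z)
    (hU : (latticeLangevinDynamics (fundamentalLatticeRep 2) β').IsSolution (fundamentalRep (Fin 2)) hW.natFiltration P W U)
    {τ₀ : ℝ≥0} (hτ₀ : 0 < (τ₀ : ℝ)) (u : ℝ≥0) :
    klDiv (P.map (U (τ₀ + u))) (wilsonMeasure (d := 3) (L := L) (fundamentalRep (Fin 2)) β') ≤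
      ENNReal.ofReal (Real.exp (-4 * ρ * u) *
        (klDiv (P.map (U τ₀)) (wilsonMeasure (d := 3) (L := L) (fundamentalRep (Fin 2)) β')).toReal) := by
  classical
  haveI := secondCountableTopology_su2
  haveI := borelSpace_config L
  set μ : Measure (GaugeConfig 3 L (Matrix.specialUnitaryGroup (Fin 2) ℂ)) :=
    wilsonMeasure (d := 3) (L := L) (fundamentalRep (Fin 2)) β' with hμ
  haveI : IsProbabilityMeasure μ :=
    isProbabilityMeasure_wilsonMeasure (d := 3) (L := L) (fundamentalRep (Fin 2)) (continuous_fundamentalRep (Fin 2)) β'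
  have hmU : ∀ t : ℝ≥0, Measurable (U t) := fun t => (hU.adapted t).mono (hW.natFiltration.le t) le_rfl
  haveI hprob : ∀ t : ℝ≥0, IsProbabilityMeasure (P.map (U t)) := fun t => Measure.isProbabilityMeasure_map (hmU t).aemeasurable
  -- THE kernels; the laws of `U` through them; Chapman–Kolmogorov
  obtain ⟨κ, hκM, -, hreal⟩ := exists_transitionKernel L β'
  haveI := hκM
  have hlaw : ∀ t : ℝ≥0, P.map (U t) = κ t z := fun t => (hreal t z Ω P W hW U hU0 hU).symm
  have hCK : P.map (U (τ₀ + u)) = (P.map (U τ₀)).bind (κ u) := by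
    rw [hlaw, hlaw, chapmanKolmogorov_szz β' κ hreal τ₀ u, Kernel.comp_apply]
  -- the density at time `τ₀`
  obtain ⟨D, hD1, hdom⟩ := map_le_smul_wilsonMeasure_of_le (L := L) β' (t₁ := τ₀) hτ₀ z
  have hdom0 : P.map (U τ₀) ≤ (ENNReal.ofReal D) • μ := by
    have := hdom Ω P W hW U hU0 hU 0
    rwa [add_zero] at this
  obtain ⟨g, hgm, hg0, hgD, hlaw0⟩ := exists_bounded_density_of_le_smul (by linarith) hdom0
  -- mass one
  have hgi : Integrable g μ := Integrable.of_bound hgm.aestronglyMeasurable D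
    (ae_of_all _ fun x => by rw [Real.norm_eq_abs, abs_of_nonneg (hg0 x)]; exact hgD x)
  have hmass : ∫ x, g x ∂μ = 1 := by
    have h1 : (μ.withDensity fun x => ENNReal.ofReal (g x)) univ = 1 := by rw [← hlaw0]; exact measure_univ
    rw [withDensity_apply _ MeasurableSet.univ, Measure.restrict_univ,
      ← ofReal_integral_eq_lintegral_ofReal hgi (ae_of_all _ hg0)] at h1
    have h2 := congrArg ENNReal.toReal h1
    rwa [ENNReal.toReal_ofReal (integral_nonneg hg0), ENNReal.toReal_one] at h2
  -- the law at `τ₀ + u` has density `κ_u g`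
  have hgb : ∀ x, |g x| ≤ D := fun x => by rw [abs_of_nonneg (hg0 x)]; exact hgD x
  have hKg_m : Measurable fun x => ∫ y, g y ∂(κ u x) := (hgm.stronglyMeasurable.integral_kernel (κ := κ u)).measurable
  have hKg0 : ∀ x, 0 ≤ ∫ y, g y ∂(κ u x) := fun x => integral_nonneg fun y => hg0 y
  have hKgD : ∀ x, ∫ y, g y ∂(κ u x) ≤ D := fun x =>
    (le_abs_self _).trans (abs_integral_le_of_abs_le_of_isProbabilityMeasure (μ := κ u x) hgb)
  have hlawu : P.map (U (τ₀ + u)) = μ.withDensity fun x => ENNReal.ofReal (∫ y, g y ∂(κ u x)) := by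
    rw [hCK, hlaw0]
    exact withDensity_bind_transition_eq L β' κ hreal u hgm hg0 hgD
  have hmassu : ∫ x, (∫ y, g y ∂(κ u x)) ∂μ = 1 := by
    rw [integral_transitionKernel_integral_eq_wilson (L := L) β' κ hreal u hgm ⟨D, hgb⟩]; exact hmass
  -- both `klDiv`s as entropies of densities
  have hK0 : klDiv (P.map (U τ₀)) μ = ENNReal.ofReal (∫ x, g x * Real.log (g x) ∂μ) := by
    rw [hlaw0]; exact klDiv_withDensity_eq_ofReal μ hgm hg0 hgD hmass
  have hKu : klDiv (P.map (U (τ₀ + u))) μ =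
      ENNReal.ofReal (∫ x, (∫ y, g y ∂(κ u x)) * Real.log (∫ y, g y ∂(κ u x)) ∂μ) := by
    rw [hlawu]; exact klDiv_withDensity_eq_ofReal μ hKg_m hKg0 hKgD hmassu
  -- the decay of the entropy of the density
  have hdec := entropy_transition_le_exp_of_generatorLogSobolev_of_measurable L β' κ hreal hρ hLSgen hgm hg0 hgD u
  rw [← hμ] at hdec
  simp only [hmassu, hmass, Real.log_one, mul_zero, sub_zero] at hdec
  -- `Ent(g) ≥ 0`
  have hglog_m : Measurable fun x => g x * Real.log (g x) := hgm.mul (Real.measurable_log.comp hgm)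
  obtain ⟨C, hC⟩ := (isCompact_Icc (a := (0 : ℝ)) (b := D)).exists_bound_of_continuousOn Real.continuous_mul_log.continuousOn
  have hglog_i : Integrable (fun x => g x * Real.log (g x)) μ :=
    Integrable.of_bound hglog_m.aestronglyMeasurable C (ae_of_all _ fun x => hC (g x) ⟨hg0 x, hgD x⟩)
  have hE0 : 0 ≤ ∫ x, g x * Real.log (g x) ∂μ := by
    have := entropy_nonneg μ hg0 hgi hglog_i
    rwa [hmass, Real.log_one, mul_zero, sub_zero] at this
  rw [hKu, hK0, ENNReal.toReal_ofReal hE0]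
  exact ENNReal.ofReal_le_ofReal hdec

end Summit.QuantumFields.YangMills.Theorems.ColdStartUniversality

end
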